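import Literature.AnabelianGeometry.EtaleTheta.SettingModelTateInversion
import Literature.AnabelianGeometry.EtaleTheta.SettingModelTateTheta
import Literature.AnabelianGeometry.EtaleTheta.SettingModelTateThetaOddShear
import Literature.AnabelianGeometry.EtaleTheta.SettingModelChiMuTwoInversion
import Literature.AnabelianGeometry.EtaleTheta.SettingModel2InversionCoverings
import Literature.AnabelianGeometry.EtaleTheta.MuTwoSettingCLevel
import HarnessLib

/-!
# The STAGE-2 («Tate shear») model of [EtTh] §1–2, part F4q-C: `Π^tp_C := Π^tp_X ⋊_ι ℤ/2`, the record
# `MuTwoSetting.modelχq p i j hj` of Def. 1.7 with C-level data, and `ε_±`-conjugation = the stage-2 inversion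

S. Mochizuki, *The étale theta function …*, Publ. RIMS **45** (2009) [EtTh], Def. 1.7 p. 27 («`X^log → C^log` … the
stack-theoretic quotient … by the natural action of `±1`», «`Ẍ → X` … the Galois covering of degree 4 determined by
the multiplication by 2 map», «`Ẍ^log → C^log` is Galois, with Galois group isomorphic to `(ℤ/2ℤ)³`») [cite:
MochizukiEtTh2009, Def 1.7 p.27]; §2 p. 36 («`1 → Δ_C → Π_C → G_K → 1`», «`ι` … "multiplication by `−1`"»), [IUTchII]
Rmk. 1.4.1 (ii) p. 28 [cite: Mochizuki2012, Rmk 1.4.1 (ii) p.28].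

Cell abc-iut, layer L2, R78 cluster STAGE 2 — the integrator's «§2 / C-level at the model» slot — seat abc-iut-w5-d249
(gen 5), over this seat's F4q/F4q-ι (`PiTpχq`, `augχq`, `inversionχq`, `invDefect_tatePairHom`), abc-iut-L2-t5's F5q
record `ThetaSetting.modelχq p i j hj` (`SettingModelTateTheta`: `levelHom_actχq_x/_y`, `YNχq`; `…OddShear`:
`levelChar_two_eq_one`, `level_two_sq`), abc-iut-L2-t1's `levelHom_gfpInv`, abc-iut-f-113's / abc-iut-w5-d140's stage-1 F8/F8ι (`SettingModelChiMuTwo(Inversion)`: `xyTwo`, `dXdd`, `dY_two_le_dXdd`, `xyTwo_gfpInv`), abc-iut-L2-d3's `MuTwoSetting.CLevelData`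
and the stage-0 pattern of abc-iut-w5-d072's `SettingModelMuTwoInversion(CLevel)` — all consumed BY NAME.

CONSTRUCTION (pure plumbing over the affine action; `hj : Even j` throughout, as in the F5q record):
* `invActionχq : ℤ/2 →* Aut(Π^tp_X)`, generator `↦ ι = inversionχq p i j` (`ι² = 1`); jointly continuous action;
* **`PiTpCq p i j := Π^tp_X ⋊_ι ℤ/2`** with the induced topology (instances on the NEW carrier only), a topological group;
  `inl : Π^tp_X → Π^tp_C` is an OPEN EMBEDDING of index `2` with normal image (`isOpenEmbedding_inlCq`, `index_range_inlCq`);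
* the PARITY homomorphism `parityχq : Π^tp_X →* ℤ/2 × ℤ/2`, `(γ, σ) ↦ (x, y)(ĥ₂(pr₁ γ))` — well defined because for EVEN
  `j` the Galois action fixes the level-`2` abelian coordinates (`χ₂ ≡ 1`, `2 ∣ jκ_p`: abc-iut-L2-t5); it is onto and
  `ι`-INVARIANT (`σ̂` negates `x, y` — invisible mod `2` — and the section shift `b^{κ_p^{j−2i}}` has even exponent);
  `Xddχq := Ker parityχq` = `Π^tp_Ẍ` («multiplication by 2»: index `4`, contains `Π^tp_Ÿ = Π^tp_{Y₂} ∩ …`);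
  `parityCq : Π^tp_C →* ℤ/2 × ℤ/2` its extension killing `ε_±`, so `Π^tp_Ẍ ↪ Π^tp_C` is `Ker parityCq ∩ Ker(Π^tp_C ↠ ℤ/2)`:
  NORMAL with quotient of exponent `2` and order `8` (`sq_mem`);
* **`MuTwoSetting.modelχq p i j hj : MuTwoSetting p`** over `ThetaSetting.modelχq p i j hj` (`K = K̈ = ℚ_p` since `q̈ = p ∈ ℚ_p`),
  `ε_μ := inl b`, `ε_± := (1, 1̄)`, with `ε_± · x · ε_±⁻¹ = ι x` (`MuTwoSetting.modelχq_epsPM_conj`).  The C-level data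
  (`augC := lift aug 1`) and «`e.conjX ε_± = inversionχq`» for every C-level datum are the sequel
  `SettingModelTateMuTwoCLevel.lean`.
HONEST LABEL: a semi-synthetic model — consistency evidence for the typed §1–2 interface, NOT the tempered fundamental group of
an orbicurve; nothing of [EtTh] is asserted; nothing here bears on [IUTchIII] Cor. 3.12; typed ≠ proved; instantiated ≠
endorsed.  Class (b) MODEL/CONSTRUCTION file (defs: `invActionχq`, `PiTpCq`, `parityχq`, `Xddχq`, `parityCq`, the
record; instances only on the new carrier `PiTpCq`).
-/

noncomputable section

namespace Literature.AnabelianGeometry.EtaleTheta.SettingModel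

open Literature.AnabelianGeometry.SemiGraphs
open Function
open _root_.Topology

variable (p : ℕ) [Fact p.Prime] (i j : ℤ)

/-! ## §1. The action of `ℤ/2` on `Π^tp_X` through the stage-2 inversion -/

/-- `ι ∘ ι = 1` in `Aut(Π^tp_X)`. [cite: MochizukiEtTh2009, §2 p.36] -/
theorem inversionχq_mul_inversionχq :
    (inversionχq p i j).toMulEquiv * (inversionχq p i j).toMulEquiv = (1 : MulAut (PiTpχq p i j)) :=
  MulEquiv.ext fun g => inversionχq_inversionχq p i j g

/-- **The action `ℤ/2 → Aut(Π^tp_X)`, generator `↦ ι`** (well defined since `ι² = 1`). [cite: MochizukiEtTh2009, Def 1.7 p.27] -/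
def invActionχq : Multiplicative (ZMod 2) →* MulAut (PiTpχq p i j) where
  toFun z := if z = 1 then 1 else (inversionχq p i j).toMulEquiv
  map_one' := if_pos rfl
  map_mul' a b := by
    have key : ∀ z : Multiplicative (ZMod 2), z = 1 ∨ z = Multiplicative.ofAdd 1 := by decide
    have hne : (Multiplicative.ofAdd (1 : ZMod 2)) ≠ 1 := by decide
    have hsq : Multiplicative.ofAdd (1 : ZMod 2) * Multiplicative.ofAdd 1 = 1 := by decide
    rcases key a with rfl | rfl <;> rcases key b with rfl | rfl
    · simp
    · simp [hne]
    · simp [hne]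
    · rw [hsq, if_pos rfl, if_neg hne, inversionχq_mul_inversionχq]

/-- The generator acts by `ι`. [cite: MochizukiEtTh2009, Def 1.7 p.27] -/
theorem invActionχq_ofAdd_one : invActionχq p i j (Multiplicative.ofAdd 1) = (inversionχq p i j).toMulEquiv := by
  change (if Multiplicative.ofAdd (1 : ZMod 2) = 1 then (1 : MulAut (PiTpχq p i j))
    else (inversionχq p i j).toMulEquiv) = _
  rw [if_neg (by decide)]

/-- Every `φ(z)` is `1` or `ι`. [cite: MochizukiEtTh2009, Def 1.7 p.27] -/
theorem invActionχq_eq_one_or (z : Multiplicative (ZMod 2)) :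
    invActionχq p i j z = 1 ∨ invActionχq p i j z = (inversionχq p i j).toMulEquiv := by
  have key : ∀ z : Multiplicative (ZMod 2), z = 1 ∨ z = Multiplicative.ofAdd 1 := by decide
  rcases key z with rfl | rfl
  · exact Or.inl (map_one _)
  · exact Or.inr (invActionχq_ofAdd_one p i j)

/-- `aug (φ(z) x) = aug x` (`ι` is over `G_{ℚ_p}`). [cite: Mochizuki2012, Rmk 1.4.1 (ii) p.28] -/
theorem augχq_invActionχq (z : Multiplicative (ZMod 2)) (x : PiTpχq p i j) :
    augχq p i j (invActionχq p i j z x) = augχq p i j x := by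
  rcases invActionχq_eq_one_or p i j z with h | h <;> rw [h]
  · rfl
  · exact augχq_inversionχq p i j x

/-- The action map `(z, x) ↦ φ(z) x` is jointly continuous (`ℤ/2` discrete, `ι` continuous).
[cite: MochizukiEtTh2009, Def 1.7 p.27] -/
theorem continuous_invActionχq_uncurry :
    Continuous fun q : Multiplicative (ZMod 2) × PiTpχq p i j => invActionχq p i j q.1 q.2 := by
  refine continuous_prod_of_discrete_left.mpr fun z => ?_
  rcases invActionχq_eq_one_or p i j z with h | h
  · simp only [h, MulAut.one_apply]; exact continuous_id
  · simp only [h]; exact (inversionχq p i j).continuous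

/-! ## §2. `Π^tp_C := Π^tp_X ⋊_ι ℤ/2` -/

/-- **`Π^tp_C := Π^tp_X ⋊_ι ℤ/2`** — the model of the tempered fundamental group of the orbicurve `C^log = X^log/{±1}` at the
stage-2 model, in which the non-identity coset acts on `Π^tp_X` by the (cocycle-corrected) inversion `ι`. A type synonym of
Mathlib's semidirect product (instances below live on it only). [cite: MochizukiEtTh2009, Def 1.7 p.27] -/
abbrev PiTpCq : Type := PiTpχq p i j ⋊[invActionχq p i j] Multiplicative (ZMod 2)

/-- The topology of `Π^tp_C`: induced along `g ↦ (g.left, g.right)`. [cite: MochizukiEtTh2009, Def 1.7 p.27] -/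
instance instTopologicalSpacePiTpCq : TopologicalSpace (PiTpCq p i j) :=
  TopologicalSpace.induced (fun g : PiTpCq p i j => (g.left, g.right)) inferInstance

/-- [cite: MochizukiEtTh2009, Def 1.7 p.27] -/
theorem isInducing_leftRightCq : IsInducing fun g : PiTpCq p i j => (g.left, g.right) := ⟨rfl⟩

/-- `Π^tp_C` is a topological group. [cite: MochizukiEtTh2009, Def 1.7 p.27] -/
instance instIsTopologicalGroupPiTpCq : IsTopologicalGroup (PiTpCq p i j) :=
  Semidirect.isTopologicalGroup_of_continuous_action (isInducing_leftRightCq p i j)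
    (continuous_invActionχq_uncurry p i j)

/-- `Π^tp_X ↪ Π^tp_C` is continuous. [cite: MochizukiEtTh2009, Def 1.7 p.27] -/
theorem continuous_inlCq : Continuous (SemidirectProduct.inl : PiTpχq p i j → PiTpCq p i j) :=
  Semidirect.continuous_inl (isInducing_leftRightCq p i j)

/-- The image of `Π^tp_X` is the kernel of `Π^tp_C ↠ ℤ/2`. [cite: MochizukiEtTh2009, Def 1.7 p.27] -/
theorem range_inlCq :
    (SemidirectProduct.inl : PiTpχq p i j →* PiTpCq p i j).range =
      (SemidirectProduct.rightHom : PiTpCq p i j →* Multiplicative (ZMod 2)).ker :=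
  SemidirectProduct.range_inl_eq_ker_rightHom

/-- The image of `Π^tp_X` is `{g | g.right = 1}`, an open set (`ℤ/2` is discrete). [cite: MochizukiEtTh2009, Def 1.7 p.27] -/
theorem isOpen_range_inlCq :
    IsOpen ((SemidirectProduct.inl : PiTpχq p i j →* PiTpCq p i j).range : Set (PiTpCq p i j)) := by
  have e : ((SemidirectProduct.inl : PiTpχq p i j →* PiTpCq p i j).range : Set (PiTpCq p i j)) =
      (fun g : PiTpCq p i j => g.right) ⁻¹' {1} := by
    rw [range_inlCq]; ext g; simp [MonoidHom.mem_ker, SemidirectProduct.rightHom]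
  rw [e]
  exact (isOpen_discrete _).preimage (Semidirect.continuous_right (isInducing_leftRightCq p i j))

/-- **`Π^tp_X ↪ Π^tp_C` is an open embedding** (field `isOpenEmbedding_inclX` of the C-level data).
[cite: MochizukiEtTh2009, Def 1.7 p.27] -/
theorem isOpenEmbedding_inlCq : IsOpenEmbedding (SemidirectProduct.inl : PiTpχq p i j → PiTpCq p i j) := by
  refine IsOpenEmbedding.of_continuous_injective_isOpenMap (continuous_inlCq p i j) SemidirectProduct.inl_injective ?_
  intro U hU
  have e : (SemidirectProduct.inl : PiTpχq p i j → PiTpCq p i j) '' U =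
      (fun g : PiTpCq p i j => g.left) ⁻¹' U ∩ (fun g : PiTpCq p i j => g.right) ⁻¹' {1} := by
    ext g
    constructor
    · rintro ⟨x, hx, rfl⟩
      exact ⟨by simpa using hx, by simp⟩
    · rintro ⟨h1, h2⟩
      refine ⟨g.left, h1, ?_⟩
      have h2' : g.right = 1 := h2
      exact SemidirectProduct.ext (by simp) (by simp [h2'])
  rw [e]
  exact (hU.preimage (Semidirect.continuous_left (isInducing_leftRightCq p i j))).inter
    ((isOpen_discrete _).preimage (Semidirect.continuous_right (isInducing_leftRightCq p i j)))

/-- `[Π^tp_C : Π^tp_X] = 2`. [cite: MochizukiEtTh2009, Def 1.7 p.27] -/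
theorem index_range_inlCq : (SemidirectProduct.inl : PiTpχq p i j →* PiTpCq p i j).range.index = 2 := by
  rw [range_inlCq, Subgroup.index_ker,
    MonoidHom.range_eq_top.mpr (SemidirectProduct.rightHom_surjective (φ := invActionχq p i j)), Subgroup.card_top]
  change Nat.card (ZMod 2) = 2
  exact Nat.card_zmod 2

/-- **`ε_± · inl x · ε_±⁻¹ = inl (ι x)`**: conjugation by `ε_± = (1, 1̄)` IS the stage-2 inversion.
[cite: MochizukiEtTh2009, §2 p.36] -/
theorem epsPM_conj_inlCq (x : PiTpχq p i j) :
    (SemidirectProduct.inr (Multiplicative.ofAdd (1 : ZMod 2)) : PiTpCq p i j) * SemidirectProduct.inl x *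
        (SemidirectProduct.inr (Multiplicative.ofAdd (1 : ZMod 2)))⁻¹ =
      SemidirectProduct.inl (inversionχq p i j x) := by
  have h := SemidirectProduct.inl_aut (φ := invActionχq p i j) (Multiplicative.ofAdd (1 : ZMod 2)) x
  rw [invActionχq_ofAdd_one] at h
  rw [← map_inv]
  exact h.symm

/-- The square of `(x, z)` is `(x · φ(z)(x), 1)` (`z² = 1` in `ℤ/2`). [cite: MochizukiEtTh2009, Def 1.7 p.27] -/
theorem sq_eq_inlCq (g : PiTpCq p i j) :
    g * g = SemidirectProduct.inl (g.left * invActionχq p i j g.right g.left) := by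
  have h2 : ∀ t : Multiplicative (ZMod 2), t * t = 1 := by decide
  exact SemidirectProduct.ext rfl (h2 _)

/-! ## §3. The parity homomorphism `Π^tp_X → ℤ/2 × ℤ/2` and `Π^tp_Ẍ` (even `j`) -/

/-- Even powers vanish at level `2`. [cite: MochizukiEtTh2009, §1 p.13] -/
theorem level_two_zpow_of_even {n : ℤ} (hn : Even n) (z : ZH) : ZHatLevel.level 2 (z ^ n) = 1 := by
  obtain ⟨m, rfl⟩ := hn
  rw [← two_mul, mul_comm, zpow_mul, zpow_ofNat, level_two_sq]

/-- **For even `j` the stage-2 Galois action fixes the level-`2` abelian coordinates** `xyTwo` (abc-iut-f-113's parity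
character of `Γ`): `χ₂ ≡ 1`, `jκ_p ≡ 0 (2)` — abc-iut-L2-t5's `levelHom_actχq_x/_y`. [cite: MochizukiEtTh2009, Def 1.7 p.27] -/
theorem xyTwo_actχq (hj : Even j) (σ : GQp p) (γ : Gfp) : xyTwo (actχq p i j σ γ) = xyTwo γ := by
  rw [xyTwo_apply, xyTwo_apply, levelHom_actχq_x, levelHom_actχq_y, levelChar_two_eq_one, level_two_zpow_of_even hj,
    toAdd_one, zero_mul, add_zero, one_mul]

/-- **The parity homomorphism `Π^tp_X → ℤ/2 × ℤ/2`** at stage 2, `(γ, σ) ↦ xyTwo γ` — the Galois group of the covering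
«determined by the multiplication by 2 map» (even `j`). [cite: MochizukiEtTh2009, Def 1.7 p.27] -/
def parityχq (hj : Even j) : PiTpχq p i j →* Multiplicative (ZMod ((2 : ℕ+) : ℕ)) × Multiplicative (ZMod ((2 : ℕ+) : ℕ)) :=
  Semidirect.leftHom xyTwo (xyTwo_actχq p i j hj)

variable (hj : Even j)

/-- [cite: MochizukiEtTh2009, Def 1.7 p.27] -/
theorem parityχq_apply (g : PiTpχq p i j) : parityχq p i j hj g = xyTwo g.left := rfl

/-- `(ℤ/2)²` has exponent `2`. [folklore] -/
private theorem sq_eq_one_z2 (t : Multiplicative (ZMod ((2 : ℕ+) : ℕ)) × Multiplicative (ZMod ((2 : ℕ+) : ℕ))) : t * t = 1 := by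
  have h : ∀ u : Multiplicative (ZMod 2) × Multiplicative (ZMod 2), u * u = 1 := by decide
  exact h t

/-- In `(ℤ/2)²` every element is its own inverse. [folklore] -/
private theorem inv_eq_self_z2 (t : Multiplicative (ZMod ((2 : ℕ+) : ℕ)) × Multiplicative (ZMod ((2 : ℕ+) : ℕ))) : t⁻¹ = t :=
  inv_eq_of_mul_eq_one_right (sq_eq_one_z2 t)

/-- The parity of `(b^t, 0)` is `(0, t mod 2)`. [cite: MochizukiEtTh2009, §1 p.13] -/
theorem xyTwo_bPowGfp (t : ZH) : xyTwo (bPowGfp t) = ((1 : Multiplicative (ZMod ((2 : ℕ+) : ℕ))), ZHatLevel.level 2 t) := by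
  rw [xyTwo_apply]
  change (Multiplicative.ofAdd (hHat 2 (bPow t)).x, Multiplicative.ofAdd (hHat 2 (bPow t)).y) = _
  rw [hHat_bPow]
  rfl

/-- **The parity is `ι`-INVARIANT** (even `j`): `parity (ι g) = parity g` — `ι_Γ` is invisible mod `2` and the section shift
`b^{κ_p^{−i−i+j}}` has an even exponent. [cite: MochizukiEtTh2009, Prop 2.2 (i) p.37] -/
theorem parityχq_inversionχq (g : PiTpχq p i j) : parityχq p i j hj (inversionχq p i j g) = parityχq p i j hj g := by
  rw [parityχq_apply, parityχq_apply, inversionχq_apply, tateInversion_left, map_mul, xyTwo_gfpInv, invDefect_tatePairHom,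
    xyTwo_bPowGfp, level_two_zpow_of_even (by obtain ⟨m, rfl⟩ := hj; exact ⟨-i + m, by ring⟩), Prod.mk_one_one, mul_one]

/-- `parity ∘ φ(z) = parity` for the `ℤ/2`-action. [cite: MochizukiEtTh2009, Prop 2.2 (i) p.37] -/
theorem parityχq_invActionχq (z : Multiplicative (ZMod 2)) (g : PiTpχq p i j) :
    parityχq p i j hj (invActionχq p i j z g) = parityχq p i j hj g := by
  rcases invActionχq_eq_one_or p i j z with h | h <;> rw [h]
  · rfl
  · exact parityχq_inversionχq p i j hj g

/-- **`Π^tp_Ẍ := Ker(parity)`** — the degree-`4` Galois covering `Ẍ → X` «determined by the multiplication by 2 map»;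
`= Δ^tp_Ẍ ⋊ G_{ℚ_p}` with abc-iut-f-113's `dXdd = Ker xyTwo`. [cite: MochizukiEtTh2009, Def 1.7 p.27] -/
def Xddχq : Subgroup (PiTpχq p i j) := (parityχq p i j hj).ker

/-- [cite: MochizukiEtTh2009, Def 1.7 p.27] -/
theorem mem_Xddχq_iff (g : PiTpχq p i j) : g ∈ Xddχq p i j hj ↔ g.left ∈ dXdd := Iff.rfl

/-- The parity is onto `(ℤ/2)²` (already on `inl(Γ)`: abc-iut-f-113's `xyTwo_surjective`). [cite: MochizukiEtTh2009, Def 1.7 p.27] -/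
theorem parityχq_surjective : Surjective (parityχq p i j hj) := fun t => by
  obtain ⟨γ, hγ⟩ := xyTwo_surjective t
  exact ⟨SemidirectProduct.inl γ, by rw [parityχq_apply, SemidirectProduct.left_inl, hγ]⟩

/-- **`[Π^tp_X : Π^tp_Ẍ] = 4`.** [cite: MochizukiEtTh2009, Def 1.7 p.27] -/
theorem index_Xddχq : (Xddχq p i j hj).index = 4 := by
  rw [Xddχq, Subgroup.index_ker, MonoidHom.range_eq_top.mpr (parityχq_surjective p i j hj), Subgroup.card_top,
    Nat.card_prod]
  change Nat.card (ZMod 2) * Nat.card (ZMod 2) = 4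
  rw [Nat.card_zmod]

/-- `Π^tp_Ẍ` is `ι`-stable (indeed `φ(z)`-stable). [cite: MochizukiEtTh2009, Def 1.7 p.27] -/
theorem invActionχq_mem_Xddχq (z : Multiplicative (ZMod 2)) {g : PiTpχq p i j} (hg : g ∈ Xddχq p i j hj) :
    invActionχq p i j z g ∈ Xddχq p i j hj := by
  rw [Xddχq, MonoidHom.mem_ker, parityχq_invActionχq]
  exact hg

/-- `parity ∘ φ(z) = parity` in the form `SemidirectProduct.lift` wants. [cite: MochizukiEtTh2009, Def 1.7 p.27] -/
theorem parityχq_comp_invActionχq (z : Multiplicative (ZMod 2)) :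
    (parityχq p i j hj).comp (invActionχq p i j z).toMonoidHom =
      (MulAut.conj ((1 : Multiplicative (ZMod 2) →* Multiplicative (ZMod ((2 : ℕ+) : ℕ)) × Multiplicative (ZMod ((2 : ℕ+) : ℕ))) z)).toMonoidHom.comp
        (parityχq p i j hj) := by
  refine MonoidHom.ext fun x => ?_
  simp only [MonoidHom.comp_apply, MulEquiv.coe_toMonoidHom, MonoidHom.one_apply, map_one, MulAut.one_apply]
  exact parityχq_invActionχq p i j hj z x

/-- The parity extended to `Π^tp_C` (killing `ε_±`): `Π^tp_C → Gal(Ẍ/X) = (ℤ/2)²`. [cite: MochizukiEtTh2009, Def 1.7 p.27] -/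
def parityCq : PiTpCq p i j →* Multiplicative (ZMod ((2 : ℕ+) : ℕ)) × Multiplicative (ZMod ((2 : ℕ+) : ℕ)) :=
  SemidirectProduct.lift (parityχq p i j hj) 1 (parityχq_comp_invActionχq p i j hj)

/-- `parityC (x, z) = parity x`. [cite: MochizukiEtTh2009, Def 1.7 p.27] -/
theorem parityCq_apply (g : PiTpCq p i j) : parityCq p i j hj g = parityχq p i j hj g.left := by
  change parityχq p i j hj g.left * (1 : Multiplicative (ZMod 2) →* Multiplicative (ZMod ((2 : ℕ+) : ℕ)) × Multiplicative (ZMod ((2 : ℕ+) : ℕ))) g.right = _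
  rw [MonoidHom.one_apply, mul_one]

/-- **`Π^tp_Ẍ ↪ Π^tp_C` is `Ker(parityC) ∩ Ker(Π^tp_C ↠ ℤ/2)`** — hence normal. [cite: MochizukiEtTh2009, Def 1.7 p.27] -/
theorem map_inl_Xddχq :
    (Xddχq p i j hj).map (SemidirectProduct.inl : PiTpχq p i j →* PiTpCq p i j) =
      (parityCq p i j hj).ker ⊓ (SemidirectProduct.rightHom : PiTpCq p i j →* Multiplicative (ZMod 2)).ker := by
  ext g
  constructor
  · rintro ⟨x, hx, rfl⟩
    refine Subgroup.mem_inf.mpr ⟨?_, ?_⟩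
    · rw [MonoidHom.mem_ker, parityCq_apply, SemidirectProduct.left_inl]; exact hx
    · rw [MonoidHom.mem_ker, SemidirectProduct.rightHom_inl]
  · intro h
    obtain ⟨h1, h2⟩ := Subgroup.mem_inf.mp h
    rw [MonoidHom.mem_ker, parityCq_apply] at h1
    rw [MonoidHom.mem_ker, SemidirectProduct.rightHom_eq_right] at h2
    refine ⟨g.left, h1, SemidirectProduct.ext (by simp) ?_⟩
    rw [SemidirectProduct.right_inl, h2]

/-- **`Ẍ^log → C^log` is Galois**: `Π^tp_Ẍ` is normal in `Π^tp_C`. [cite: MochizukiEtTh2009, Def 1.7 p.27] -/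
theorem map_inl_Xddχq_normal : ((Xddχq p i j hj).map (SemidirectProduct.inl : PiTpχq p i j →* PiTpCq p i j)).Normal := by
  rw [map_inl_Xddχq]
  infer_instance

/-- **`Gal(Ẍ/C)` has exponent `2`** (hence `≅ (ℤ/2)³`, its order being `4·2 = 8`): every square of `Π^tp_C` lies in `Π^tp_Ẍ`.
[cite: MochizukiEtTh2009, Def 1.7 p.27] -/
theorem sq_mem_map_inl_Xddχq (g : PiTpCq p i j) :
    g * g ∈ (Xddχq p i j hj).map (SemidirectProduct.inl : PiTpχq p i j →* PiTpCq p i j) := by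
  rw [map_inl_Xddχq]
  refine Subgroup.mem_inf.mpr ⟨?_, ?_⟩
  · rw [MonoidHom.mem_ker, map_mul]
    exact sq_eq_one_z2 _
  · rw [MonoidHom.mem_ker, map_mul]
    have h2 : ∀ t : Multiplicative (ZMod 2), t * t = 1 := by decide
    exact h2 _

/-- `Π^tp_{Y₂} ≤ Π^tp_Ẍ`: an element of `Δ^tp_{Y₂} ⋊ G_{K_2}` has degree-`0`, `z`-axis level — parity `1`.
[cite: MochizukiEtTh2009, Def 1.7 p.27] -/
theorem YNχq_two_le_Xddχq : YNχq p i j 2 ≤ Xddχq p i j hj := by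
  intro g hg
  have hg' : g ∈ (tateTwistData₀ p i j).YN 2 (fieldKN ⊥ (qModel p) 2).fixingSubgroup := hg
  obtain ⟨hY, -⟩ := (GfpTwistData₀.mem_YN _).mp hg'
  exact (mem_Xddχq_iff p i j hj g).mpr (dY_two_le_dXdd hY)

/-- `Π^tp_Ÿ ≤ Π^tp_Ẍ` for the record `modelχq` (`Π^tp_Ÿ = Π^tp_{Y₂} ∩ aug⁻¹(G_{J̈₁}) ≤ Π^tp_{Y₂}`).
[cite: MochizukiEtTh2009, Def 1.7 p.27] -/
theorem GtpYdd_modelχq_le_Xddχq : (ThetaSetting.modelχq p i j hj).GtpYdd ≤ Xddχq p i j hj := by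
  intro g hg
  have hg2 : g ∈ (ThetaSetting.modelχq p i j hj).GtpYN (2 * 1) := (Subgroup.mem_inf.mp hg).1
  rw [mul_one] at hg2
  exact YNχq_two_le_Xddχq p i j hj hg2

/-- `ε_μ := inl b ∉ Π^tp_Ẍ` (parity `(0, 1)`). [cite: MochizukiEtTh2009, Def 1.7 p.27] -/
theorem inl_b_not_mem_Xddχq : (SemidirectProduct.inl (gfpOf (FreeGroup.of 1)) : PiTpχq p i j) ∉ Xddχq p i j hj := by
  rw [mem_Xddχq_iff, SemidirectProduct.left_inl, mem_dXdd_iff, levelHom_gfpOf, heisHom_of_one, Heis.map_apply]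
  rintro ⟨-, h⟩
  have h1 : ((1 : ℤ) : ZMod 2) = 0 := h
  exact absurd h1 (by decide)

/-! ## §4. The record `MuTwoSetting.modelχq` of Def. 1.7 at the stage-2 model -/

/-- **The Def. 1.7 record at the stage-2 («Tate shear») model.**  Over abc-iut-L2-t5's `ThetaSetting.modelχq p i j hj`
(`K = K̈ = ℚ_p`, `q̈ = p`): `Π^tp_C := Π^tp_X ⋊_ι ℤ/2` with `ι` the cocycle-corrected stage-2 inversion, `Π^tp_Ẍ := Ker(parity)`,
`ε_μ := b`, `ε_± := (1, 1̄)` — so that conjugation by `ε_±` on `Π^tp_X` is `ι`. Semi-synthetic; consistency evidence only.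
[cite: MochizukiEtTh2009, Def 1.7 p.27] -/
abbrev _root_.Literature.AnabelianGeometry.EtaleTheta.MuTwoSetting.modelχq : MuTwoSetting p where
  toThetaSetting := ThetaSetting.modelχq p i j hj
  sqrtqX_mem_K := natCast_mem _ _
  GtpC := PiTpCq p i j
  inclX := SemidirectProduct.inl
  continuous_inclX := continuous_inlCq p i j
  injective_inclX := SemidirectProduct.inl_injective
  isOpen_range_inclX := isOpen_range_inlCq p i j
  range_inclX_normal := by
    rw [range_inlCq]
    infer_instance
  index_range_inclX := index_range_inlCq p i j
  GtpXdd := Xddχq p i j hj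
  index_GtpXdd := index_Xddχq p i j hj
  map_GtpXdd_normal := map_inl_Xddχq_normal p i j hj
  sq_mem_GtpXdd := sq_mem_map_inl_Xddχq p i j hj
  GtpYdd_le_GtpXdd := GtpYdd_modelχq_le_Xddχq p i j hj
  epsMu := SemidirectProduct.inl (SemidirectProduct.inl (gfpOf (FreeGroup.of 1)))
  epsMu_mem := ⟨_, rfl⟩
  epsMu_not_mem := by
    rintro ⟨y, hy, hyy⟩
    have h := SemidirectProduct.inl_injective hyy
    subst h
    exact inl_b_not_mem_Xddχq p i j hj hy
  epsPM := SemidirectProduct.inr (Multiplicative.ofAdd 1)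
  epsPM_not_mem := by
    rintro ⟨y, hy⟩
    have h := congrArg (SemidirectProduct.rightHom (φ := invActionχq p i j)) hy
    rw [SemidirectProduct.rightHom_inl, SemidirectProduct.rightHom_inr] at h
    exact absurd h (by decide)

/-- The Def. 1.7 record sits over the stage-2 root record. [cite: MochizukiEtTh2009, Def 1.7 p.27] -/
theorem _root_.Literature.AnabelianGeometry.EtaleTheta.MuTwoSetting.modelχq_toThetaSetting :
    (MuTwoSetting.modelχq p i j hj).toThetaSetting = ThetaSetting.modelχq p i j hj := rfl

/-- Its `ε_±` is `(1, 1̄)`. [cite: MochizukiEtTh2009, Def 1.7 p.27] -/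
theorem _root_.Literature.AnabelianGeometry.EtaleTheta.MuTwoSetting.modelχq_epsPM :
    (MuTwoSetting.modelχq p i j hj).epsPM = SemidirectProduct.inr (Multiplicative.ofAdd 1) := rfl

/-- `ε_± · x · ε_±⁻¹ = ι x` for the record. [cite: MochizukiEtTh2009, §2 p.36] -/
theorem _root_.Literature.AnabelianGeometry.EtaleTheta.MuTwoSetting.modelχq_epsPM_conj (x : PiTpχq p i j) :
    (MuTwoSetting.modelχq p i j hj).epsPM * (MuTwoSetting.modelχq p i j hj).inclX x * (MuTwoSetting.modelχq p i j hj).epsPM⁻¹ =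
      (MuTwoSetting.modelχq p i j hj).inclX (inversionχq p i j x) :=
  epsPM_conj_inlCq p i j x

/-- **Non-vacuity**: `MuTwoSetting p` has an inhabitant over the stage-2 root with the Tate shear.
[cite: MochizukiEtTh2009, Def 1.7 p.27] -/
theorem _root_.Literature.AnabelianGeometry.EtaleTheta.MuTwoSetting.exists_toThetaSetting_eq_modelχq :
    ∃ M : MuTwoSetting p, M.toThetaSetting = ThetaSetting.modelχq p i j hj :=
  ⟨MuTwoSetting.modelχq p i j hj, rfl⟩

end Literature.AnabelianGeometry.EtaleTheta.SettingModel

end
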